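import Literature.MathematicalPhysics.QuantumFieldTheory.Balaban1983to89.Node00.CriticalOnFibreGauge
import Literature.MathematicalPhysics.QuantumFieldTheory.Balaban1983to89.Node00.CarriersB8Cube
import Literature.MathematicalPhysics.QuantumFieldTheory.Balaban1983to89.Node00.Sect2RegionGeometry
import Literature.MathematicalPhysics.QuantumFieldTheory.Balaban1983to89.B3GkZeroTorusRescaled

/-!
# NODE 00 — THE TORUS→`ℤᵈ` TWIN, FILE 2: the COLLARED CUBE of [15] (144) ∕ [6] Sect. F on the cover — a grid cube `□ ⊆ Ω_n` of the record's torus,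
# its lift `□♯ = cubeExt (LⁿM) a 0 = box L (M·a) M n`, the Proposition-6 cube `𝔔 ⊇ □♯` of side `M′ = M + 11d + L` blocks with collar `𝔔̃` (`ρ = L`),
# the SEPARATION MARGIN «dist(Ω_n, Ωᶜ_{n−1}) ≥ LⁿM₁» (`Sect2.SeqSeparated`) putting `π(𝔔̃)` inside `Ω_{n−1}`, and the AMBIENT MEMBER of n05-a's index
# `ZdIdx` with all levels `:= 𝔔̃` carrying `𝔔` as a `Node00.CubeB8` datum

Cell `pub-ymgap`, seat `pub-ymgap-dag-n07-e` generation 10 (R141 (C) s3 «torus-vs-box twin», DAG node N07 = [15]; INTENT-25 programme FILE 26, bus 2026-08-27).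
NEW leaf; CONSUMED BY NAME, nothing modified: node00-def-cube's `Node00.CubeB8`, n05-a's `B8LeafModelZd.ZdIdx`, `B8Eq131Cubes.(box, tcube, bLo, bHi, tLo, tHi)`,
`B8Ineq130.(tlo, thi)`, `B7Prop1Local.InBox`, r11's `B14DomainGeom.(Within, IdxNear, enl, idxNear_of_within)`, `B14.Eq213MaximalDomains.(side, cubeExt)`, r15's
`B15Eq112TorusCover.cover`, def-R's `cubeEnl`, node00-def-P11's `Sect2.enlT` ∕ `Sect2.SeqSeparated`, r11's `B14.Eq218Concrete.Seq`.
`--kind definition --supports stmt-QuantumFields-20506` (K0⁶, WORDS-142).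
[15] = [Balaban1985Variational]; [6] = [Balaban1985RegularSpaces]; [I] = [Balaban1987RG1]; [III] = [Balaban1988Convergent].

WHY.  The K0 road reads [15] Theorem 1 (9) line 1 through `Node00.Gauge9RegSepTopStep ⟸ Prop8RegSepTopStep ∧ Gauge152OfClassTopStep` (this seat, g9) at the
record's cube letter `M = 1` (node00-def-K0a FILE 21 `exists_k0SepCoPR_of_thm1RegSepCoP7M_of_gauge9TopStep_of_betaBox`, p536433): the gauge is wanted on every grid
cube `□ = cubeEnl (F.P K) (LⁿM) a 0 ⊆ Ω_n` (and `L^{n+1}M`).  [6] Proposition 6 — in the tree at NODE 00's `ℤᵈ` objects, `Node00.zdCub ∕ GaugedBoundB8` — is stated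
for cubes «of size MLʲη, M a multiple of R₁M₁» with «11d < M» ((1.130), GAPS G-B8-14) inside an ambient family with «□̃ ⊂ Ω_{k−1}» (p. 98).  [15] p. 300 L23–30:
«Let us take a cube □ intersecting Ω_j but not Ω_{j+1}, of a size 2MLʲη … M ≧ R₁M₁ … we construct the sequence of cubes {□_n} and the cube □̃ … (144) …
□̃ ⊂ B_{j−1}(Λ_{j−1}) ∪ B_j(Λ_j)».  THIS FILE supplies that geometry ON THE COVER for an arbitrary grid cube of the record: the lift `□♯` of `□` is a `box` of
n05-a's cube algebra; it sits inside the Proposition-6 cube `𝔔 = box L (M·a) (M + 11d + L) n` whose collar `𝔔̃ = tcube L (M·a) (M + 11d + L) L n` stays within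
sup-distance `(11d + 3L)·Lⁿ` of `□♯` (§2), hence — by print's separation of admissible sequences, [6] (1.3)–(1.6) ∕ [III] p. 256, typed by def-P11 as
`Sect2.SeqSeparated M₁ s` («one layer of LⁿM₁-cubes around Ω_n lies in Ω_{n−1}») — `π(𝔔̃) ⊆ Ω_{n−1}` as soon as `11d + 3L ≤ M₁` and `2 ≤ n` (§1, §3).  §4 is
the ambient member of n05-a's `ZdIdx d L` the bridge feeds to Proposition 6: spacing `η_n = L⁻ⁿ`, `k := n` levels ALL EQUAL TO `𝔔̃` (print p. 98 «we can drop
out the domains Ω_{j′}» — the far torus scales are never read; `Λs` = the single sites of `𝔔̃` at level `0`, `Λb = ∅`, so the index laws hold trivially), with `𝔔`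
as its `CubeB8` datum (`11d < M′`, `L ≤ ρ = L ≤ M′`, `L ≤ dM′`, `□ ⊂ Ω_k`, `□̃ ⊂ Ω_{k−1}` all by construction).  §5: the threshold bookkeeping `η_{n−1}^p ≤ L³·η_j^p`
(`j ≤ n`, `p ≤ 3`) that makes ONE class constant `α = L³·ε_{n−1}` serve every level of the member (FILE 25's `inAk_zdLift_of_top` with `lvl ≡ n − 1`).
FILE 27 (sequel) applies `B8.Prop6Printed … (fun i => zdCub 𝔸 L i)` at this member and datum to the lift `zdLift N U` (FILE 25, p537387) and reads
`GaugedBoundB8` back as the torus letters of `Gauge152OfClassTopStep`.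

WHAT IS PROVED (kernel; every `Params`, general `Seq D k`; NO estimate of Bałaban — lattice geometry and bookkeeping only).
§1 `cover_mem_of_within_of_seqSeparated` — `SeqSeparated M₁ s`, `1 ≤ n < k`, `π y ∈ Ω_{n+1}`, `z` within `L^{n+1}M₁` of `y` (sup-norm) ⇒ `π z ∈ Ω_n`.
§2 `cubeExt_side_eq_box` (`cubeExt (LⁿM) a 0 = box L (M·a) M n`) · `box_subset_box_of_le` · `box_subset_tcube_of_le` · ★ `exists_mem_box_within_of_mem_tcube`
   (every point of `tcube L a M′ ρ n` is within `(M′ − M + 2ρ)·Lⁿ` of a point of `box L a M n`, `1 ≤ M ≤ M′` — the clamp).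
§3 ★★ `cover_image_tcube_subset_of_seqSeparated` — `2 ≤ n ≤ k`, `cubeEnl P (side L M n) a 0 ⊆ s.Ω n`, `SeqSeparated M₁ s`, `t + 2ρ ≤ M₁`, `1 ≤ M`
   ⇒ `π '' tcube L (M·a) (M + t) ρ n ⊆ s.Ω (n − 1)`.
§4 `constIdx` (the ambient `ZdIdx` member: spacing `η`, `k` levels all equal to one cover set `Q`) · `propCube` (the `CubeB8` datum `𝔔` of a grid cube at the member
   `cubeIdx' P n hn M a := constIdx L (η_n) n (tcube …)`) · `rfl` field lemmas (the member's `0 < η_n` is r03's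
   `B3GkZeroTorusRescaled.eta_pos`) · `cubeExt_subset_box_propCube` (`□♯ ⊆ 𝔔`) · ★ `cover_image_Ω_cubeIdx'_subset`
   (every level of the member projects into `Ω_{n−1}`: `2 ≤ n ≤ k`, `□ ⊆ Ω_n`, separated sequence, `11d + 3L ≤ M₁`).
§5 `eta_pow_le_L_cube_mul_eta_pow` (`j ≤ n`, `p ≤ 3` ⇒ `η_{n−1}^p ≤ L³·η_j^p`) · `tol_of_level_pred` (the two threshold dominations FILE 25's reading asks for, at
   `α = L³·ε_{n−1}`).
HONEST FRAMING: definitions and lattice-geometric bookkeeping only — nothing of Bałaban asserted or discharged; N07 ∕ N05 ∕ K0⁶ NOT discharged; counts unmoved (5∕27);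
one finite T⁴ programme at fixed ε — NOT continuum ∕ ℝ⁴ ∕ infinite volume ∕ OS ∕ mass gap ∕ Clay.  No `sorry`, no `instance`, no `notation`.
-/

noncomputable section

namespace Literature.MathematicalPhysics.QuantumFieldTheory.Balaban1983to89.Node00

open scoped Matrix.Norms.L2Operator
open B15Eq112TorusCover (cover per cover_add_pmul)
open B14DomainGeom (Pt Within IdxNear enl idxNear_of_within)
open B14.Eq213MaximalDomains (side cubeExt)
open B7Prop1Local (InBox)
open B8Ineq130 (tlo thi tlo_apply thi_apply)
open B8Eq131Cubes (box tcube tLo tHi bLo bHi)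
open B8LeafModelZd (ZdIdx)

/-! ## §1  Print's separation of the sequence, read pointwise on the cover -/

section Separation

variable {P : Params} {D : ℕ → Set (Set (Site P 0))} {k : ℕ}

/-- ★ **«dist(Ω_{n+1}, Ωᶜ_n) ≥ L^{n+1}M₁» ON THE COVER** ([6] (1.3)–(1.6) ∕ [III] p. 256, as typed by `Sect2.SeqSeparated`): if `π y ∈ Ω_{n+1}` and `z ∈ ℤᵈ` is within
sup-distance `L^{n+1}M₁` of `y`, then `π z ∈ Ω_n` (`1 ≤ n < k`). [cite: Balaban1985RegularSpaces, (1.3)–(1.6) p.77; Balaban1988Convergent, (2.1) p.254, p.256] -/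
theorem cover_mem_of_within_of_seqSeparated {M₁ : ℕ} (hM₁ : 1 ≤ M₁) (s : B14.Eq218Concrete.Seq D k) (hsep : Sect2.SeqSeparated M₁ s)
    {n : ℕ} (hn : 1 ≤ n) (hnk : n < k) {y z : Pt P.d} (hy : cover P y ∈ s.Ω (n + 1))
    (hz : Within (side P.L M₁ (n + 1) : ℤ) z y) : cover P z ∈ s.Ω n := by
  refine hsep n hn hnk ⟨z, ⟨y, hy, ?_⟩, rfl⟩
  refine idxNear_of_within _ 1 (B14.Eq213MaximalDomains.side_pos P.L_pos hM₁ _) ?_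
  simpa only [Nat.cast_one, one_mul] using hz

end Separation

/-! ## §2  The lifted grid cube `□♯`, the Proposition-6 cube `𝔔 ⊇ □♯` and its collar `𝔔̃` in n05-a's cube algebra -/

section Boxes

variable {d : ℕ}

/-- **THE LIFT OF A GRID CUBE IS A `box`**: def-R's `s`-cube of index `a` on the cover with `s = LⁿM` (`cubeExt (LⁿM) a 0`, so that `cubeEnl P (LⁿM) a 0 = π '' (…)`) IS
n05-a's `box L (M·a) M n = [Lⁿ·(Ma), Lⁿ·(Ma + M))ᵈ`. [cite: Balaban1988Convergent, (2.17) p.257; Balaban1985RegularSpaces, p.98 («□^{(k)}»)] -/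
theorem cubeExt_side_eq_box (L M n : ℕ) (a : Pt d) :
    cubeExt (side L M n) a 0 = box L (fun i => (M : ℤ) * a i) M n := by
  ext z
  simp only [cubeExt, side, Nat.cast_mul, Nat.cast_pow, sub_zero, add_zero, Set.mem_setOf_eq, box, InBox, bLo, bHi,
    Nat.cast_zero]
  refine forall_congr' fun i => ?_
  have e1 : (L : ℤ) ^ n * ((M : ℤ) * a i) = (L : ℤ) ^ n * M * a i := by ring
  have e2 : (L : ℤ) ^ n * ((M : ℤ) * a i + M) - 1 = (L : ℤ) ^ n * M * a i + (L : ℤ) ^ n * M - 1 := by ring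
  rw [e1, e2]

/-- A box with the same corner and a larger side contains the smaller one. [cite: Balaban1985RegularSpaces, p.98 (bookkeeping)] -/
theorem box_subset_box_of_le (L : ℕ) (a : Pt d) {M M' : ℕ} (h : M ≤ M') (n : ℕ) : box L a M n ⊆ box L a M' n := by
  intro z hz i
  obtain ⟨h1, h2⟩ := hz i
  refine ⟨h1, h2.trans ?_⟩
  simp only [bHi]
  have hL : (0 : ℤ) ≤ (L : ℤ) ^ n := by positivity
  have : (L : ℤ) ^ n * (a i + M) ≤ (L : ℤ) ^ n * (a i + M') := mul_le_mul_of_nonneg_left (by omega) hL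
  linarith

/-- A box lies inside the collared cube of any box with the same corner and at least its side: `box L a M n ⊆ tcube L a M′ ρ n` (`M ≤ M′`).
[cite: Balaban1985RegularSpaces, p.98 («□ ⊂ □̃»)] -/
theorem box_subset_tcube_of_le (L : ℕ) (a : Pt d) {M M' : ℕ} (h : M ≤ M') (ρ n : ℕ) : box L a M n ⊆ tcube L a M' ρ n := by
  intro z hz i
  obtain ⟨h1, h2⟩ := hz i
  simp only [bLo, bHi, Nat.cast_zero, sub_zero, add_zero] at h1 h2
  rw [tlo_apply, thi_apply]
  simp only [tLo, tHi]
  have hL : (0 : ℤ) ≤ (L : ℤ) ^ n := by positivity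
  constructor
  · have : (L : ℤ) ^ n * (a i - 2 * ρ) ≤ (L : ℤ) ^ n * a i := mul_le_mul_of_nonneg_left (by omega) hL
    linarith
  · have : (L : ℤ) ^ n * (a i + M) ≤ (L : ℤ) ^ n * (a i + M' - 1 + 2 * ρ + 1) := mul_le_mul_of_nonneg_left (by omega) hL
    linarith

/-- ★ **THE COLLAR STAYS NEAR THE CUBE** (the clamp): every point of `tcube L a M′ ρ n` lies within sup-distance `(M′ − M + 2ρ)·Lⁿ` of a point of `box L a M n`
(`1 ≤ M ≤ M′`) — [15] (144)'s «dist(□̃, …) = 2R₁M₁Lʲη» plus the side surplus. [cite: Balaban1985Variational, (144) p.300; Balaban1985RegularSpaces, p.98] -/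
theorem exists_mem_box_within_of_mem_tcube {L : ℕ} (hL1 : 1 ≤ L) (a : Pt d) {M M' : ℕ} (hM : 1 ≤ M) (h : M ≤ M') (ρ n : ℕ) {z : Pt d}
    (hz : z ∈ tcube L a M' ρ n) :
    ∃ y ∈ box L a M n, Within ((((M' - M + 2 * ρ) * L ^ n : ℕ) : ℤ)) z y := by
  have hL : (1 : ℤ) ≤ (L : ℤ) ^ n := by exact_mod_cast Nat.one_le_pow n L hL1
  -- the clamp of `z` into the box `[lo, hi]`, `lo = Lⁿ·a`, `hi = Lⁿ·(a + M) − 1`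
  set lo : Pt d := fun i => (L : ℤ) ^ n * a i with hlo
  set hi : Pt d := fun i => (L : ℤ) ^ n * (a i + M) - 1 with hhi
  have hlohi : ∀ i, lo i ≤ hi i := fun i => by
    simp only [hlo, hhi]
    have : (L : ℤ) ^ n * a i + (L : ℤ) ^ n * 1 ≤ (L : ℤ) ^ n * (a i + M) := by
      rw [← mul_add]; exact mul_le_mul_of_nonneg_left (by omega) (by linarith)
    linarith
  refine ⟨fun i => max (lo i) (min (z i) (hi i)), fun i => ?_, fun i => ?_⟩
  · simp only [bLo, bHi, Nat.cast_zero, sub_zero, add_zero]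
    exact ⟨le_max_left _ _, max_le (hlohi i) (min_le_right _ _)⟩
  · dsimp only
    obtain ⟨h1, h2⟩ := hz i
    rw [tlo_apply] at h1
    rw [thi_apply] at h2
    simp only [tLo, tHi] at h1 h2
    have hcast : ((((M' - M + 2 * ρ) * L ^ n : ℕ) : ℤ)) = ((M' : ℤ) - M + 2 * ρ) * (L : ℤ) ^ n := by
      push_cast [Nat.cast_sub h]; ring
    rw [hcast, abs_le]
    have hmargin : (0 : ℤ) ≤ ((M' : ℤ) - M + 2 * ρ) * (L : ℤ) ^ n := mul_nonneg (by omega) (by linarith)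
    have hlo_z : lo i - z i ≤ ((M' : ℤ) - M + 2 * ρ) * (L : ℤ) ^ n := by
      have e : lo i - (L : ℤ) ^ n * (a i - 2 * ρ) = (2 * ρ) * (L : ℤ) ^ n := by simp only [hlo]; ring
      have h3 : (0 : ℤ) ≤ ((M' : ℤ) - M) * (L : ℤ) ^ n := mul_nonneg (by omega) (by linarith)
      nlinarith
    have hz_hi : z i - hi i ≤ ((M' : ℤ) - M + 2 * ρ) * (L : ℤ) ^ n := by
      have e : ((L : ℤ) ^ n * (a i + M' - 1 + 2 * ρ + 1) - 1) - hi i = ((M' : ℤ) - M + 2 * ρ) * (L : ℤ) ^ n := by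
        simp only [hhi]; ring
      linarith
    constructor
    · -- `-(margin) ≤ z i - y i`, i.e. `y i ≤ z i + margin`; `y i ≤ max (lo i) (z i)`
      rcases le_total (lo i) (z i) with hc | hc
      · have hy : max (lo i) (min (z i) (hi i)) ≤ z i := max_le hc (min_le_left _ _)
        linarith
      · have hy : max (lo i) (min (z i) (hi i)) ≤ lo i := max_le le_rfl ((min_le_left _ _).trans hc)
        linarith
    · -- `z i - y i ≤ margin`; `y i ≥ min (z i) (hi i)`
      rcases le_total (z i) (hi i) with hc | hc
      · have hy : z i ≤ max (lo i) (min (z i) (hi i)) := by rw [min_eq_left hc]; exact le_max_right _ _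
        linarith
      · have hy : hi i ≤ max (lo i) (min (z i) (hi i)) := by rw [min_eq_right hc]; exact le_max_right _ _
        linarith

end Boxes

/-! ## §3  The collar of the Proposition-6 cube of a grid cube `□ ⊆ Ω_n` projects into `Ω_{n−1}` -/

section Collar

variable {P : Params} {D : ℕ → Set (Set (Site P 0))} {k : ℕ}

/-- ★★ **[15] (144) ∕ [6] p. 98 «□̃ ⊂ Ω_{k−1}» FOR A GRID CUBE OF THE RECORD, ON THE COVER.**  For a separated sequence (`Sect2.SeqSeparated M₁ s`), a scale
`2 ≤ n ≤ k`, a grid cube `□ = cubeEnl P (LⁿM) a 0 ⊆ Ω_n` (`1 ≤ M`) and a side surplus `t` and collar width `ρ` with `t + 2ρ ≤ M₁`: the collared cube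
`𝔔̃ = tcube L (M·a) (M + t) ρ n` of the cover projects into `Ω_{n−1}`. [cite: Balaban1985Variational, (144) p.300 («□̃ ⊂ B_{j−1}(Λ_{j−1}) ∪ B_j(Λ_j)»); Balaban1985RegularSpaces, p.98 («□̃ ⊂ Ω_{k−1}»), (1.3)–(1.6) p.77] -/
theorem cover_image_tcube_subset_of_seqSeparated {M₁ : ℕ} (hM₁ : 1 ≤ M₁) (s : B14.Eq218Concrete.Seq D k) (hsep : Sect2.SeqSeparated M₁ s)
    {n : ℕ} (hn : 2 ≤ n) (hnk : n ≤ k) {M : ℕ} (hM : 1 ≤ M) (a : Pt P.d) (hΩ : cubeEnl P (side P.L M n) a 0 ⊆ s.Ω n)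
    {t ρ : ℕ} (ht : t + 2 * ρ ≤ M₁) :
    cover P '' tcube P.L (fun i => (M : ℤ) * a i) (M + t) ρ n ⊆ s.Ω (n - 1) := by
  rintro _ ⟨z, hz, rfl⟩
  have hL1 : 1 ≤ P.L := P.L_pos
  obtain ⟨y, hy, hzy⟩ := exists_mem_box_within_of_mem_tcube hL1 _ hM (Nat.le_add_right M t) ρ n hz
  have hy' : cover P y ∈ s.Ω n := by
    refine hΩ ⟨y, ?_, rfl⟩
    simp only [Nat.zero_mul, Nat.cast_zero]
    rw [cubeExt_side_eq_box]
    exact hy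
  obtain ⟨m, rfl⟩ : ∃ m, n = m + 1 := ⟨n - 1, by omega⟩
  rw [Nat.add_sub_cancel]
  refine cover_mem_of_within_of_seqSeparated hM₁ s hsep (by omega) (by omega) hy' fun i => (hzy i).trans ?_
  rw [Nat.add_sub_cancel_left, side]
  have hL : (0 : ℤ) ≤ (P.L : ℤ) ^ (m + 1) := by positivity
  push_cast
  nlinarith

end Collar

/-! ## §4  The ambient member of n05-a's `ZdIdx` (all levels equal to one cover set) and the Proposition-6 cube as its `CubeB8` datum -/

section Member

variable {d : ℕ}

/-- **THE AMBIENT MEMBER WITH ALL LEVELS EQUAL TO ONE COVER SET `Q`** (print p. 98: «we can drop out the domains Ω_{j′}, j′ > j, from our assumptions»; here also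
the finer ones are replaced by `Q` itself, which only WEAKENS what the class `𝔄_k({Ω_j}, α)` asks outside `Q` — nothing — and is all Proposition 6 reads): spacing
`η > 0`, `k ≥ 1` levels `Ω_j := Q`; constraint data of n05-a's index: the single sites of `Q` at level `0` (`Λs m 0 := Q`, else `∅`), no constraint bonds
(`Λb := ∅`), so the tower ∕ partition laws hold by `rfl`. [cite: Balaban1985RegularSpaces, (1.3)–(1.5) p.77, p.98] -/
def constIdx (L : ℕ) (η : ℝ) (hη : 0 < η) (k : ℕ) (hk : 1 ≤ k) (Q : Set (B7Prop1Explicit.Site d)) : ZdIdx d L where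
  η := η
  hη := hη
  k := k
  hk := hk
  Ω := fun _ => Q
  hΩ := fun _ => le_rfl
  Λs := fun _ j => if j = 0 then Q else ∅
  Λb := fun _ _ => ∅
  hbox := fun _ _ _ _ c hc => (Set.notMem_empty c hc).elim
  hclass := fun _ _ _ _ c hc => (Set.notMem_empty c hc).elim
  htower := by
    intro j _ y hy x hx
    by_cases hj : j = 0
    · subst hj
      rw [if_pos rfl] at hy
      have hxy : x = y := funext fun i => le_antisymm (hx i).2 (hx i).1
      rw [hxy]; exact hy
    · rw [if_neg hj] at hy
      exact (Set.notMem_empty y hy).elim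
  hpart := fun x hx => ⟨0, Nat.zero_le _, x, by rw [if_pos rfl]; exact hx, fun i => ⟨le_rfl, le_rfl⟩⟩

/-- The member's spacing. [cite: Balaban1985RegularSpaces, (1.3) p.77 (bookkeeping)] -/
@[simp] theorem constIdx_η (L : ℕ) (η : ℝ) (hη : 0 < η) (k : ℕ) (hk : 1 ≤ k) (Q : Set (B7Prop1Explicit.Site d)) : (constIdx L η hη k hk Q).η = η := rfl

/-- The member's number of levels. [cite: Balaban1985RegularSpaces, (1.3) p.77 (bookkeeping)] -/
@[simp] theorem constIdx_k (L : ℕ) (η : ℝ) (hη : 0 < η) (k : ℕ) (hk : 1 ≤ k) (Q : Set (B7Prop1Explicit.Site d)) : (constIdx L η hη k hk Q).k = k := rfl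

/-- The member's levels are all `Q`. [cite: Balaban1985RegularSpaces, (1.3) p.77 (bookkeeping)] -/
@[simp] theorem constIdx_Ω (L : ℕ) (η : ℝ) (hη : 0 < η) (k : ℕ) (hk : 1 ≤ k) (Q : Set (B7Prop1Explicit.Site d)) (j : ℕ) :
    (constIdx L η hη k hk Q).Ω j = Q := rfl

variable (P : Params)

/-- **THE AMBIENT MEMBER OF A GRID CUBE** `□ = cubeEnl P (LⁿM) a 0` of scale `n ≥ 1`: spacing `η_n = L⁻ⁿ`, `n` levels, all equal to the collared Proposition-6 cube
`𝔔̃ = tcube L (M·a) (M + 11d + L) L n`. [cite: Balaban1985Variational, (144) p.300; Balaban1985RegularSpaces, p.98] -/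
def cubeIdx' (n : ℕ) (hn : 1 ≤ n) (M : ℕ) (a : Pt P.d) : ZdIdx P.d P.L :=
  constIdx P.L (P.eta n) (B3GkZeroTorusRescaled.eta_pos P n) n hn (tcube P.L (fun i => (M : ℤ) * a i) (M + 11 * P.d + P.L) P.L n)

/-- **THE PROPOSITION-6 CUBE `𝔔` OF A GRID CUBE AS A `Node00.CubeB8` DATUM of the member `cubeIdx' P n hn M a`**: scale `k := n`, corner `M·a`, side
`M′ := M + 11d + L` blocks («11d < M′» (1.130), «L ≤ ρ ≤ M′» with `ρ := L`, print's implicit `L ≤ dM′`), «□ ⊂ Ω_k» and «□̃ ⊂ Ω_{k−1}» by construction (every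
level of the member is `𝔔̃ ⊇ 𝔔`). [cite: Balaban1985RegularSpaces, p.98, (1.130) p.99, Prop. 6 p.99; Balaban1985Variational, (144) p.300] -/
def propCube (n : ℕ) (hn : 1 ≤ n) (M : ℕ) (a : Pt P.d) :
    CubeB8 P.d P.L (cubeIdx' P n hn M a).k (cubeIdx' P n hn M a).Ω where
  k := n
  a := fun i => (M : ℤ) * a i
  M := M + 11 * P.d + P.L
  ρ := P.L
  one_le_k := hn
  k_le := le_rfl
  L_le_ρ := le_rfl
  ρ_le_M := by omega
  big := by have := P.hL.2; omega
  L_le_dM := by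
    have := P.hd
    calc P.L ≤ M + 11 * P.d + P.L := by omega
      _ = 1 * (M + 11 * P.d + P.L) := (one_mul _).symm
      _ ≤ P.d * (M + 11 * P.d + P.L) := Nat.mul_le_mul_right _ this
  box_sub := box_subset_tcube_of_le P.L _ le_rfl P.L n
  tcube_sub := le_rfl

/-- The datum's scale index is `n`. [cite: Balaban1985RegularSpaces, Prop. 6 p.99 (bookkeeping)] -/
@[simp] theorem propCube_k (n : ℕ) (hn : 1 ≤ n) (M : ℕ) (a : Pt P.d) : (propCube P n hn M a).k = n := rfl

/-- The datum's side is `M′ = M + 11d + L`. [cite: Balaban1985RegularSpaces, (1.130) p.99 (bookkeeping)] -/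
@[simp] theorem propCube_M (n : ℕ) (hn : 1 ≤ n) (M : ℕ) (a : Pt P.d) : (propCube P n hn M a).M = M + 11 * P.d + P.L := rfl

/-- The datum's collar width is `ρ = L`. [cite: Balaban1985RegularSpaces, p.98 (bookkeeping)] -/
@[simp] theorem propCube_ρ (n : ℕ) (hn : 1 ≤ n) (M : ℕ) (a : Pt P.d) : (propCube P n hn M a).ρ = P.L := rfl

/-- The datum's corner is `M·a`. [cite: Balaban1985RegularSpaces, p.98 (bookkeeping)] -/
@[simp] theorem propCube_a (n : ℕ) (hn : 1 ≤ n) (M : ℕ) (a : Pt P.d) : (propCube P n hn M a).a = fun i => (M : ℤ) * a i := rfl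

/-- The member's levels are the datum's collared cube `𝔔̃ = tcube L (M·a) M′ L n`. [cite: Balaban1985RegularSpaces, p.98 (bookkeeping)] -/
theorem cubeIdx'_Ω (n : ℕ) (hn : 1 ≤ n) (M : ℕ) (a : Pt P.d) (j : ℕ) :
    (cubeIdx' P n hn M a).Ω j = tcube P.L (fun i => (M : ℤ) * a i) (M + 11 * P.d + P.L) P.L n := rfl

/-- The member's spacing is `η_n`. [cite: Balaban1987RG1, (1.1) p.260 (bookkeeping)] -/
theorem cubeIdx'_η (n : ℕ) (hn : 1 ≤ n) (M : ℕ) (a : Pt P.d) : (cubeIdx' P n hn M a).η = P.eta n := rfl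

/-- The member has `n` levels. [cite: Balaban1985RegularSpaces, (1.3) p.77 (bookkeeping)] -/
theorem cubeIdx'_k (n : ℕ) (hn : 1 ≤ n) (M : ℕ) (a : Pt P.d) : (cubeIdx' P n hn M a).k = n := rfl

/-- **`□♯ ⊆ 𝔔`**: the lift of the grid cube lies in the datum's cube `box L (M·a) M′ n`. [cite: Balaban1985Variational, (144) p.300 («□_k ⊃ □»)] -/
theorem cubeExt_subset_box_propCube (n : ℕ) (hn : 1 ≤ n) (M : ℕ) (a : Pt P.d) :
    cubeExt (side P.L M n) a 0 ⊆ box P.L (propCube P n hn M a).a (propCube P n hn M a).M (propCube P n hn M a).k := by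
  rw [cubeExt_side_eq_box]
  exact box_subset_box_of_le P.L _ (by simp only [propCube_M]; omega) n

/-- **`π(𝔔̃) ⊆ Ω_{n−1}`** for the member of a grid cube `□ ⊆ Ω_n` of a SEPARATED sequence, `2 ≤ n ≤ k`, `1 ≤ M`, under the located numerics floor
`11d + 3L ≤ M₁` (the collar and side surplus of the Proposition-6 cube must fit in print's separation layer). [cite: Balaban1985Variational, (144) p.300; Balaban1985RegularSpaces, p.98, (1.3)–(1.6) p.77] -/
theorem cover_image_Ω_cubeIdx'_subset {D : ℕ → Set (Set (Site P 0))} {k : ℕ} {M₁ : ℕ} (s : B14.Eq218Concrete.Seq D k)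
    (hsep : Sect2.SeqSeparated M₁ s) (hfloor : 11 * P.d + 3 * P.L ≤ M₁) {n : ℕ} (hn : 2 ≤ n) (hnk : n ≤ k) {M : ℕ} (hM : 1 ≤ M) (a : Pt P.d)
    (hΩ : cubeEnl P (side P.L M n) a 0 ⊆ s.Ω n) (j : ℕ) :
    cover P '' (cubeIdx' P n (by omega) M a).Ω j ⊆ s.Ω (n - 1) := by
  have hL := P.hL.2
  rw [cubeIdx'_Ω, show M + 11 * P.d + P.L = M + (11 * P.d + P.L) by ring]
  exact cover_image_tcube_subset_of_seqSeparated (by omega) s hsep hn hnk hM a hΩ (by omega)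

end Member

/-! ## §5  One class constant for all levels of the member: `η_{n−1}^p ≤ L³·η_j^p` -/

section Tolerance

variable (P : Params)

/-- `η_{n−1}^p ≤ L³·η_j^p` for `j ≤ n` and `p ≤ 3` (`η_j = L⁻ʲ`, `L ≥ 1`): the level-`(n−1)` torus threshold read at any level `j ≤ n` of the member costs at most
`L³`. [cite: Balaban1985RegularSpaces, (1.7)–(1.9) p.77 (bookkeeping)] -/
theorem eta_pow_le_L_cube_mul_eta_pow {n j p : ℕ} (hn : 1 ≤ n) (hj : j ≤ n) (hp : p ≤ 3) :
    P.eta (n - 1) ^ p ≤ (P.L : ℝ) ^ 3 * P.eta j ^ p := by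
  have hL1 : (1 : ℝ) ≤ P.L := by exact_mod_cast P.L_pos
  have hLpos : (0 : ℝ) < P.L := by positivity
  have h0 : (0 : ℝ) ≤ (P.L : ℝ)⁻¹ := by positivity
  have h1 : (P.L : ℝ)⁻¹ ≤ 1 := inv_le_one_of_one_le₀ hL1
  simp only [Params.eta, ← pow_mul]
  have hexp : (n - 1) * p + 3 ≥ j * p := by
    have : j * p ≤ n * p := Nat.mul_le_mul_right _ hj
    have h2 : n * p = (n - 1) * p + p := by
      obtain ⟨m, rfl⟩ : ∃ m, n = m + 1 := ⟨n - 1, by omega⟩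
      simp [add_mul]
    omega
  calc ((P.L : ℝ)⁻¹) ^ ((n - 1) * p) = (P.L : ℝ) ^ 3 * (((P.L : ℝ)⁻¹) ^ ((n - 1) * p) * ((P.L : ℝ)⁻¹) ^ 3) := by
        rw [inv_pow _ 3, mul_comm (((P.L : ℝ)⁻¹) ^ _), ← mul_assoc, mul_inv_cancel₀ (pow_ne_zero _ hLpos.ne'), one_mul]
    _ = (P.L : ℝ) ^ 3 * ((P.L : ℝ)⁻¹) ^ ((n - 1) * p + 3) := by rw [pow_add]
    _ ≤ (P.L : ℝ) ^ 3 * ((P.L : ℝ)⁻¹) ^ (j * p) :=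
        mul_le_mul_of_nonneg_left (pow_le_pow_of_le_one h0 h1 hexp) (by positivity)

/-- **THE THRESHOLD DOMINATIONS OF FILE 25's READING AT `α = L³·ε_{n−1}`**: `ε_{n−1}·η_{n−1}² ≤ (L³ε_{n−1})·η_j²` and `ε_{n−1}·η_{n−1}³ ≤ (L³ε_{n−1})·η_j³` for
every level `j ≤ n` of the member (`0 ≤ ε_{n−1}`). [cite: Balaban1985RegularSpaces, (1.7)–(1.9) p.77 (bookkeeping)] -/
theorem tol_of_level_pred {ε : ℕ → ℝ} {n : ℕ} (hn : 1 ≤ n) (hε : 0 ≤ ε (n - 1)) {j : ℕ} (hj : j ≤ n) :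
    ε (n - 1) * P.eta (n - 1) ^ 2 ≤ (P.L : ℝ) ^ 3 * ε (n - 1) * P.eta j ^ 2 ∧
      ε (n - 1) * P.eta (n - 1) ^ 3 ≤ (P.L : ℝ) ^ 3 * ε (n - 1) * P.eta j ^ 3 := by
  have h2 := eta_pow_le_L_cube_mul_eta_pow P hn hj (by norm_num : 2 ≤ 3)
  have h3 := eta_pow_le_L_cube_mul_eta_pow P hn hj (le_refl 3)
  constructor
  · calc ε (n - 1) * P.eta (n - 1) ^ 2 ≤ ε (n - 1) * ((P.L : ℝ) ^ 3 * P.eta j ^ 2) := mul_le_mul_of_nonneg_left h2 hε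
      _ = (P.L : ℝ) ^ 3 * ε (n - 1) * P.eta j ^ 2 := by ring
  · calc ε (n - 1) * P.eta (n - 1) ^ 3 ≤ ε (n - 1) * ((P.L : ℝ) ^ 3 * P.eta j ^ 3) := mul_le_mul_of_nonneg_left h3 hε
      _ = (P.L : ℝ) ^ 3 * ε (n - 1) * P.eta j ^ 3 := by ring

end Tolerance

end Literature.MathematicalPhysics.QuantumFieldTheory.Balaban1983to89.Node00

end
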